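import Summits.HubbardSuperconductivity.HubbardSuperconductivity.Theses.CooperPairDMottWalk
import Summits.HubbardSuperconductivity.HubbardSuperconductivity.Theorems.CooperPairDMottWalkGlue

/-!
# Route `CooperPairDMottWalk`, crux `BindingWalk` (stmt-HubbardSuperconductivity-1176): reductions to the target

Helper file (`--supports stmt-HubbardSuperconductivity-1176`), pure logic over the route's statements (no
definition, no named fact). The crux `BindingWalk` is the implication

  corner hypothesis (= `CooperPairDMott` at one `U₀ ∈ [2,4]`)  →  body of the target `PureCooperPair`,

and its consequent is the target `PureCooperPair` (stmt-HubbardSuperconductivity-1175) VERBATIM. Hence: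

* `bindingWalk_of_pureCooperPair : PureCooperPair → BindingWalk` — the target closes the crux outright
  (the corner hypothesis is not used): whoever settles stmt-1175 positively settles stmt-1176;
* `bindingWalk_iff_pureCooperPair : CooperPairDMott → (BindingWalk ↔ PureCooperPair)` — given the corner
  crux (stmt-HubbardSuperconductivity-1177), the walk IS the target (forward direction =
  `cruxesGiveTarget_proof`, stmt-14352);
* `not_pureCooperPair_of_not_bindingWalk : ¬ BindingWalk → ¬ PureCooperPair` — a refutation of the crux
  is at least as hard as a refutation of the target (and, since `¬ (A → B)` gives `A`, it would moreover
  PROVE the corner hypothesis at some `U₀ ∈ [2,4]`, i.e. the conclusion of `CooperPairDMott` there).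

These record, for the line lead's census, exactly where the crux sits between its neighbours: it has no
content independent of stmt-1175 once stmt-1177 holds, and no refutation independent of stmt-1177.
Sources: the route file (planner, 2026-08-15/16); D. J. Scalapino, Phys. Rep. 250 (1995) 329 §2 for the
pair-binding vocabulary. [folklore]
-/

set_option linter.dupNamespace false

namespace Summit.HubbardSuperconductivity.HubbardSuperconductivity.Theorems.CooperPairDMottWalk

open Summit.HubbardSuperconductivity.HubbardSuperconductivity.Theses.CooperPairDMottWalk

/-- **The target closes the crux.** `PureCooperPair → BindingWalk`: the consequent of `BindingWalk` is
the body of `PureCooperPair` verbatim (same `let CP`, same quantifiers), so the implication holds with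
the corner hypothesis discarded. [folklore] -/
theorem bindingWalk_of_pureCooperPair : PureCooperPair → BindingWalk :=
  fun hX _ => hX

/-- **Given the corner crux, the walk is the target.** `CooperPairDMott → (BindingWalk ↔ PureCooperPair)`:
forward by `cruxesGiveTarget_proof` (instantiate the corner at `U₀ = 2`), backward by
`bindingWalk_of_pureCooperPair`. [folklore] -/
theorem bindingWalk_iff_pureCooperPair (hD : CooperPairDMott) : BindingWalk ↔ PureCooperPair :=
  ⟨fun hW => cruxesGiveTarget_proof hD hW, bindingWalk_of_pureCooperPair⟩

/-- **A refutation of the crux refutes the target.** `¬ BindingWalk → ¬ PureCooperPair`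
(contrapositive of `bindingWalk_of_pureCooperPair`). [folklore] -/
theorem not_pureCooperPair_of_not_bindingWalk (h : ¬ BindingWalk) : ¬ PureCooperPair :=
  fun hX => h (bindingWalk_of_pureCooperPair hX)

end Summit.HubbardSuperconductivity.HubbardSuperconductivity.Theorems.CooperPairDMottWalk
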